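import Summits.QuantumFields.GaugeBoot.TwistedSlabHaar
import HarnessLib

/-!
# Convolution powers of class functions and their two-sided Haar averages (gauge-boot, L3 supplement)

HONEST FRAMING (cell `pub-gaugeboot`, page 1 of every file): the venture produces certified bounds
on lattice expectations at stated coupling, gauge group, dimension and torus size; NOT a mass gap,
NOT a continuum limit, NOT a string tension; NOT Yang–Mills-summit-bearing (barriers
`FixedCouplingUltralocality`, `PerturbativeInvisibility`). This module is group-theoretic
bookkeeping for a POSITIVE structural result (`DiagonalRPTorusEvenGaugeInvariantAllGroups.lean`):
on the even two-torus, diagonal reflection positivity holds in the gauge-invariant sector at EVERY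
real coupling for EVERY compact gauge group.

For a compact group `G` with normalised Haar measure `dy` and real functions `u, v, w : G → ℝ`:

* `conv u v x = ∫ u(x y⁻¹) v(y) dy` — convolution; `cpow w n` — the `(n+1)`-st convolution power
  `w ⋆ ⋯ ⋆ w`; `twoSided u C D = ∫ u(x C x⁻¹ D⁻¹) dx` — the two-sided (bi-class) average;
* `integral_mul_inv_mul_eq_conv`: `∫ u(X y⁻¹) v(y Y) dy = (u ⋆ v)(X Y)` (the gluing rule);
* class functions (`u(g k g⁻¹) = u k`) and inversion-symmetric functions (`u(k⁻¹) = u k`) are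
  preserved (`conv_conj`, `conv_inv`, `cpow_conj`, `cpow_inv`); `conv_assoc`, `conv_cpow_cpow`
  (`w^{⋆(a+1)} ⋆ w^{⋆(b+1)} = w^{⋆(a+b+2)}`);
* `twoSided_symm` (`A_u(C, D) = A_u(D, C)` for symmetric class `u`), `twoSided_conj_left/right`,
  and ★ `twoSided_conv`: `A_{u⋆v}(C, D) = ∫ A_u(C, h) A_v(h, D) dh` for class functions `u, v` —
  so `A_{u⋆u}` is a positive-semidefinite kernel, with NO sign condition on `u`.

In characters `A_u(C, D) = Σ_λ (û_λ/d_λ) χ_λ(C) conj χ_λ(D)` and everything here is the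
convolution calculus of the centre of the group algebra (Migdal's 2D gluing rules); the point of
the file is that it is proved by Fubini and Haar invariance alone, WITHOUT Peter–Weyl. All
statements are `[folklore]` (T. Bröcker, T. tom Dieck, GTM 98 (1985) II §4; A. A. Migdal,
Sov. Phys. JETP 42 (1975) 413; J.-M. Drouffe, J.-B. Zuber, Phys. Rep. 102 (1983) 1, §3).
-/

noncomputable section

open MeasureTheory
open Literature.MathematicalPhysics.QuantumFieldTheory (haarProbability)

namespace Summit.QuantumFields.GaugeBoot

namespace ClassConv

variable {G : Type*} [Group G] [TopologicalSpace G] [IsTopologicalGroup G] [CompactSpace G]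
  [MeasurableSpace G] [BorelSpace G]

/-! ## Analytic bookkeeping on compact spaces -/

/-- A continuous function on a compact space with values in a second-countable normed group is
integrable for every finite measure. [folklore] -/
theorem integrable_of_continuous {X E : Type*} [TopologicalSpace X] [CompactSpace X]
    [MeasurableSpace X] [OpensMeasurableSpace X] [NormedAddCommGroup E]
    [SecondCountableTopology E] {μ : Measure X} [IsFiniteMeasure μ] {f : X → E}
    (hf : Continuous f) : Integrable f μ := by
  obtain ⟨C, hC⟩ := isCompact_univ.exists_bound_of_continuousOn hf.continuousOn
  exact Integrable.of_bound hf.aestronglyMeasurable C (ae_of_all _ fun x => hC x (Set.mem_univ x))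

/-- Parametric Haar integrals of jointly continuous functions are continuous (compact parameter
space; dominated convergence with a uniform bound). [folklore] -/
theorem continuous_integral_of_continuous [SecondCountableTopology G] {X : Type*}
    [TopologicalSpace X] [FirstCountableTopology X] [CompactSpace X] {F : X → G → ℝ}
    (hF : Continuous (Function.uncurry F)) :
    Continuous fun x => ∫ y, F x y ∂(haarProbability G) := by
  obtain ⟨C, hC⟩ := isCompact_univ.exists_bound_of_continuousOn hF.continuousOn
  refine continuous_of_dominated (F := F) (bound := fun _ => C) (fun x => ?_)
    (fun x => ae_of_all _ fun y => ?_) (integrable_const C) (ae_of_all _ fun y => ?_)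
  · exact (hF.comp (Continuous.prodMk_right x)).aestronglyMeasurable
  · exact hC (x, y) (Set.mem_univ _)
  · exact hF.comp (Continuous.prodMk_left y)

/-! ## Convolution -/

/-- **Convolution** of two real functions on `G` with respect to normalised Haar measure:
`(u ⋆ v)(x) = ∫ u(x y⁻¹) v(y) dy`. [folklore] -/
def conv (u v : G → ℝ) (x : G) : ℝ := ∫ y, u (x * y⁻¹) * v y ∂(haarProbability G)

/-- The convolution of continuous functions is continuous. [folklore] -/
theorem continuous_conv [SecondCountableTopology G] {u v : G → ℝ} (hu : Continuous u)
    (hv : Continuous v) : Continuous (conv u v) :=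
  continuous_integral_of_continuous (F := fun x y => u (x * y⁻¹) * v y)
    ((hu.comp (continuous_fst.mul continuous_snd.inv)).mul (hv.comp continuous_snd))

/-- **The gluing rule**: `∫ u(X y⁻¹) v(y Y) dy = (u ⋆ v)(X Y)` (right invariance of Haar
measure). [folklore] -/
theorem integral_mul_inv_mul_eq_conv (u v : G → ℝ) (X Y : G) :
    ∫ y, u (X * y⁻¹) * v (y * Y) ∂(haarProbability G) = conv u v (X * Y) := by
  unfold conv
  have h := integral_mul_right_eq_self (μ := haarProbability G)
    (fun y => u (X * Y * y⁻¹) * v y) Y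
  have hpt : ∀ y : G, u (X * Y * (y * Y)⁻¹) * v (y * Y) = u (X * y⁻¹) * v (y * Y) := fun y => by
    rw [show X * Y * (y * Y)⁻¹ = X * y⁻¹ by group]
  simp only [hpt] at h
  exact h

/-- Convolution preserves class functions. [folklore] -/
theorem conv_conj {u v : G → ℝ} (hu : ∀ g k, u (g * k * g⁻¹) = u k)
    (hv : ∀ g k, v (g * k * g⁻¹) = v k) (g x : G) : conv u v (g * x * g⁻¹) = conv u v x := by
  unfold conv
  have h := TwistedSlab.integral_conj_eq_self (fun y => u (g * x * g⁻¹ * y⁻¹) * v y) g⁻¹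
  rw [inv_inv] at h
  rw [← h]
  refine integral_congr_ae (ae_of_all _ fun y => ?_)
  show u (g * x * g⁻¹ * (g * y * g⁻¹)⁻¹) * v (g * y * g⁻¹) = u (x * y⁻¹) * v y
  rw [show g * x * g⁻¹ * (g * y * g⁻¹)⁻¹ = g * (x * y⁻¹) * g⁻¹ by group, hu, hv]

/-- Convolution of an inversion-symmetric class function with an inversion-symmetric function is
inversion symmetric. [folklore] -/
theorem conv_inv {u v : G → ℝ} (hu : ∀ g k, u (g * k * g⁻¹) = u k) (hus : ∀ k, u k⁻¹ = u k)
    (hvs : ∀ k, v k⁻¹ = v k) (x : G) : conv u v x⁻¹ = conv u v x := by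
  unfold conv
  rw [← integral_inv_eq_self (fun y => u (x⁻¹ * y⁻¹) * v y) (haarProbability G)]
  refine integral_congr_ae (ae_of_all _ fun y => ?_)
  show u (x⁻¹ * y⁻¹⁻¹) * v y⁻¹ = u (x * y⁻¹) * v y
  rw [inv_inv, hvs, show x⁻¹ * y = (y⁻¹ * x)⁻¹ by group, hus, ← hu x (y⁻¹ * x),
    show x * (y⁻¹ * x) * x⁻¹ = x * y⁻¹ by group]

/-- Convolution is associative (continuous functions). [folklore] -/
theorem conv_assoc [SecondCountableTopology G] {u v w : G → ℝ} (hu : Continuous u)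
    (hv : Continuous v) (hw : Continuous w) : conv (conv u v) w = conv u (conv v w) := by
  funext x
  -- right side: `∫ t, u(x t⁻¹) ∫ z, v(t z⁻¹) w z = ∫ t ∫ z, u(x t⁻¹) v(t z⁻¹) w z`
  have hR : conv u (conv v w) x =
      ∫ t, ∫ z, u (x * t⁻¹) * (v (t * z⁻¹) * w z) ∂(haarProbability G) ∂(haarProbability G) := by
    unfold conv
    exact integral_congr_ae (ae_of_all _ fun t => (integral_const_mul _ _).symm)
  have hF : Continuous (Function.uncurry fun t z : G => u (x * t⁻¹) * (v (t * z⁻¹) * w z)) :=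
    (hu.comp (continuous_const.mul continuous_fst.inv)).mul
      ((hv.comp (continuous_fst.mul continuous_snd.inv)).mul (hw.comp continuous_snd))
  rw [hR, integral_integral_swap (integrable_of_continuous hF)]
  unfold conv
  refine integral_congr_ae (ae_of_all _ fun z => ?_)
  dsimp only
  have h1 := integral_mul_inv_mul_eq_conv u v x z⁻¹
  unfold conv at h1
  rw [← h1, ← integral_mul_const]
  exact integral_congr_ae (ae_of_all _ fun t => by ring)

/-! ## Convolution powers -/

/-- `cpow w n = w ⋆ ⋯ ⋆ w` with `n + 1` factors (so `cpow w 0 = w`). [folklore] -/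
def cpow (w : G → ℝ) : ℕ → G → ℝ
  | 0 => w
  | n + 1 => conv (cpow w n) w

/-- `cpow w 0 = w`. -/
@[simp] theorem cpow_zero (w : G → ℝ) : cpow w 0 = w := rfl

/-- `cpow w (n+1) = cpow w n ⋆ w`. -/
theorem cpow_succ (w : G → ℝ) (n : ℕ) : cpow w (n + 1) = conv (cpow w n) w := rfl

/-- Convolution powers of a continuous function are continuous. [folklore] -/
theorem continuous_cpow [SecondCountableTopology G] {w : G → ℝ} (hw : Continuous w) (n : ℕ) :
    Continuous (cpow w n) := by
  induction n with
  | zero => exact hw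
  | succ n ih => exact continuous_conv ih hw

/-- Convolution powers of a class function are class functions. [folklore] -/
theorem cpow_conj {w : G → ℝ} (hw : ∀ g k, w (g * k * g⁻¹) = w k) (n : ℕ) (g x : G) :
    cpow w n (g * x * g⁻¹) = cpow w n x := by
  induction n generalizing g x with
  | zero => exact hw g x
  | succ n ih => exact conv_conj (fun g k => ih g k) hw g x

/-- Convolution powers of an inversion-symmetric class function are inversion symmetric.
[folklore] -/
theorem cpow_inv {w : G → ℝ} (hw : ∀ g k, w (g * k * g⁻¹) = w k) (hws : ∀ k, w k⁻¹ = w k)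
    (n : ℕ) (x : G) : cpow w n x⁻¹ = cpow w n x := by
  induction n generalizing x with
  | zero => exact hws x
  | succ n ih => exact conv_inv (fun g k => cpow_conj hw n g k) (fun k => ih k) hws x

/-- `w^{⋆(a+1)} ⋆ w^{⋆(b+1)} = w^{⋆(a+b+2)}`. [folklore] -/
theorem conv_cpow_cpow [SecondCountableTopology G] {w : G → ℝ} (hw : Continuous w) (a b : ℕ) :
    conv (cpow w a) (cpow w b) = cpow w (a + b + 1) := by
  induction b with
  | zero => rfl
  | succ b ih =>
    rw [cpow_succ, ← conv_assoc (continuous_cpow hw a) (continuous_cpow hw b) hw, ih,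
      show a + (b + 1) + 1 = (a + b + 1) + 1 by ring]
    rfl

/-! ## Two-sided Haar averages -/

/-- **The two-sided average** `A_u(C, D) = ∫ u(x C x⁻¹ D⁻¹) dx` — a function of the pair of
conjugacy classes of `C` and `D` when `u` is a class function. [folklore] -/
def twoSided (u : G → ℝ) (C D : G) : ℝ := ∫ x, u (x * C * x⁻¹ * D⁻¹) ∂(haarProbability G)

/-- `A_u` is jointly continuous in `(C, D)` for continuous `u`. [folklore] -/
theorem continuous_twoSided [SecondCountableTopology G] {u : G → ℝ} (hu : Continuous u) :
    Continuous fun p : G × G => twoSided u p.1 p.2 :=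
  continuous_integral_of_continuous (X := G × G) (F := fun p x => u (x * p.1 * x⁻¹ * p.2⁻¹))
    (hu.comp (((continuous_snd.mul (continuous_fst.comp continuous_fst)).mul
      continuous_snd.inv).mul (continuous_snd.comp continuous_fst).inv))

/-- `|A_u(C, D)| ≤ sup |u|`. [folklore] -/
theorem abs_twoSided_le {u : G → ℝ} {B : ℝ} (hB : ∀ k, |u k| ≤ B) (C D : G) :
    |twoSided u C D| ≤ B := by
  unfold twoSided
  refine (abs_integral_le_integral_abs (μ := haarProbability G)).trans ?_
  refine (integral_mono_of_nonneg (ae_of_all _ fun x => abs_nonneg _) (integrable_const B)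
    (ae_of_all _ fun x => hB _)).trans ?_
  simp

/-- Conjugating the first argument does not change the two-sided average. [folklore] -/
theorem twoSided_conj_left (u : G → ℝ) (X C D : G) :
    twoSided u (X * C * X⁻¹) D = twoSided u C D := by
  unfold twoSided
  rw [← integral_mul_right_eq_self (μ := haarProbability G)
    (fun x => u (x * C * x⁻¹ * D⁻¹)) X]
  refine integral_congr_ae (ae_of_all _ fun x => ?_)
  show u (x * (X * C * X⁻¹) * x⁻¹ * D⁻¹) = u (x * X * C * (x * X)⁻¹ * D⁻¹)
  rw [show x * (X * C * X⁻¹) * x⁻¹ * D⁻¹ = x * X * C * (x * X)⁻¹ * D⁻¹ by group]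

/-- Conjugating the second argument does not change the two-sided average of a class function.
[folklore] -/
theorem twoSided_conj_right {u : G → ℝ} (hu : ∀ g k, u (g * k * g⁻¹) = u k) (X C D : G) :
    twoSided u C (X * D * X⁻¹) = twoSided u C D := by
  unfold twoSided
  rw [← integral_mul_left_eq_self (μ := haarProbability G)
    (fun x => u (x * C * x⁻¹ * D⁻¹)) X⁻¹]
  refine integral_congr_ae (ae_of_all _ fun x => ?_)
  show u (x * C * x⁻¹ * (X * D * X⁻¹)⁻¹) = u (X⁻¹ * x * C * (X⁻¹ * x)⁻¹ * D⁻¹)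
  rw [← hu X⁻¹ (x * C * x⁻¹ * (X * D * X⁻¹)⁻¹)]
  congr 1
  group

/-- **Symmetry**: `A_u(C, D) = A_u(D, C)` for an inversion-symmetric class function `u`.
[folklore] -/
theorem twoSided_symm {u : G → ℝ} (hu : ∀ g k, u (g * k * g⁻¹) = u k) (hus : ∀ k, u k⁻¹ = u k)
    (C D : G) : twoSided u C D = twoSided u D C := by
  unfold twoSided
  rw [← integral_inv_eq_self (fun x => u (x * D * x⁻¹ * C⁻¹)) (haarProbability G)]
  refine integral_congr_ae (ae_of_all _ fun x => ?_)
  show u (x * C * x⁻¹ * D⁻¹) = u (x⁻¹ * D * x⁻¹⁻¹ * C⁻¹)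
  rw [← hus (x * C * x⁻¹ * D⁻¹), ← hu x⁻¹ (x * C * x⁻¹ * D⁻¹)⁻¹]
  congr 1
  group

omit [TopologicalSpace G] [IsTopologicalGroup G] [CompactSpace G] [MeasurableSpace G] [BorelSpace G] in
/-- The class property of `u` in the form used for two-sided averages:
`u(x C x⁻¹ D⁻¹) = u(D⁻¹ x C x⁻¹)`. [folklore] -/
theorem apply_conj_mul_inv_eq {u : G → ℝ} (hu : ∀ g k, u (g * k * g⁻¹) = u k) (x C D : G) :
    u (x * C * x⁻¹ * D⁻¹) = u (D⁻¹ * (x * C * x⁻¹)) := by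
  rw [← hu D⁻¹ (x * C * x⁻¹ * D⁻¹)]
  congr 1
  group

/-- ★ **The convolution rule for two-sided averages**: for continuous class functions `u, v`,
`A_{u⋆v}(C, D) = ∫ A_u(C, h) A_v(h, D) dh`. With `v = u` symmetric this exhibits `A_{u⋆u}` as a
positive-semidefinite kernel `∫ A_u(C, h) A_u(D, h) dh`, whatever the sign of `u`. [folklore] -/
theorem twoSided_conv [SecondCountableTopology G] {u v : G → ℝ} (hu : Continuous u)
    (hv : Continuous v) (huc : ∀ g k, u (g * k * g⁻¹) = u k) (hvc : ∀ g k, v (g * k * g⁻¹) = v k)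
    (C D : G) :
    twoSided (conv u v) C D =
      ∫ h, twoSided u C h * twoSided v h D ∂(haarProbability G) := by
  -- the joint integrand
  set F : G → G → G → ℝ := fun h x y => u (x * C * x⁻¹ * h⁻¹) * v (y * h * y⁻¹ * D⁻¹) with hF
  have hFc : Continuous fun p : G × G × G => F p.1 p.2.1 p.2.2 := by
    simp only [hF]
    refine (hu.comp ?_).mul (hv.comp ?_)
    · exact (((continuous_fst.comp continuous_snd).mul continuous_const).mul
        (continuous_fst.comp continuous_snd).inv).mul continuous_fst.inv
    · exact (((continuous_snd.comp continuous_snd).mul continuous_fst).mul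
        (continuous_snd.comp continuous_snd).inv).mul continuous_const
  -- step 1: the product of the two averages is a double integral
  have h1 : ∀ h : G, twoSided u C h * twoSided v h D =
      ∫ x, ∫ y, F h x y ∂(haarProbability G) ∂(haarProbability G) := by
    intro h
    unfold twoSided
    rw [← integral_mul_const]
    exact integral_congr_ae (ae_of_all _ fun x => (integral_const_mul _ _).symm)
  simp_rw [h1]
  -- step 2: move the `h`-integral inside
  have hcont_xy : Continuous (Function.uncurry fun h x => ∫ y, F h x y ∂(haarProbability G)) := by
    refine continuous_integral_of_continuous (X := G × G) (F := fun p y => F p.1 p.2 y) ?_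
    exact hFc.comp ((continuous_fst.comp continuous_fst).prodMk
      ((continuous_snd.comp continuous_fst).prodMk continuous_snd))
  rw [integral_integral_swap (integrable_of_continuous hcont_xy)]
  have hswap : ∀ x : G, ∫ h, ∫ y, F h x y ∂(haarProbability G) ∂(haarProbability G) =
      ∫ y, ∫ h, F h x y ∂(haarProbability G) ∂(haarProbability G) := fun x =>
    integral_integral_swap (integrable_of_continuous (hFc.comp
      (continuous_fst.prodMk (continuous_const.prodMk continuous_snd))))
  simp_rw [hswap]
  -- step 3: the innermost `h`-integral is the gluing rule
  have h3 : ∀ x y : G, ∫ h, F h x y ∂(haarProbability G) =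
      conv u v ((y * x) * C * (y * x)⁻¹ * D⁻¹) := by
    intro x y
    have hpt : ∀ h, F h x y = u (x * C * x⁻¹ * h⁻¹) * v (h * (y⁻¹ * D⁻¹ * y)) := fun h => by
      simp only [hF]
      rw [← hvc y⁻¹ (y * h * y⁻¹ * D⁻¹)]
      congr 2
      group
    simp_rw [hpt]
    rw [integral_mul_inv_mul_eq_conv, ← conv_conj huc hvc y]
    congr 1
    group
  simp_rw [h3]
  -- step 4: left invariance in `x`, then the `y`-integral of a constant
  have h4 : ∀ x : G, ∫ y, conv u v (y * x * C * (y * x)⁻¹ * D⁻¹) ∂(haarProbability G) =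
      twoSided (conv u v) C D := fun x =>
    integral_mul_right_eq_self (μ := haarProbability G) (fun z => conv u v (z * C * z⁻¹ * D⁻¹)) x
  simp_rw [h4]
  simp

end ClassConv

end Summit.QuantumFields.GaugeBoot

end
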